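import Summits.HodgeConjecture.HodgeConjecture.Theorems.SignSymmetricPowersSignThreefoldPowersHodgeOffMeagre
import Literature.AlgebraicGeometry.HodgeTheory.GriffithsHolomorphicHodgeSubbundlesQPHolds
import HarnessLib

/-!
# Route `SignSymmetricPowers` — reading (a)-B «OFF-MEAGRE-B», UNCONDITIONAL: off ONE meagre subset of the space of ι-even quinary
# forms of degree `d`, the sign-deck clauses of crux K1-B hold and the Hodge conjecture holds on ALL self fibre powers

Support file for crux K1-B `VeryGeneralSignCommutatorsInHg` (stmt-HodgeConjecture-19716; `--supports … --as helper`, nothing here closes an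
item).  Prover seat `hodge-nonav-19716-p2` (g12, cell `hodge-nonav`).  `SignSymmetricPowersSignThreefoldPowersHodgeOffMeagre` (this seat, same
day) proved the analytic K1-B and the rung-F-H1 leaf OFF A MEAGRE SET of ι-even forms CONDITIONAL on the quasi-projective form of Griffiths'
theorem, `Griffiths1968_holomorphicHodgeSubbundlesQP`; the cell's programme GRIFFITHS-HOLOMORPHY (prover-Bx g17–g18, 20241-p1 g19–g20, this seat
g11: harmonic `L²`-stability of the Hodge filtration + Osgood kernel frames in chart balls) has now PROVED that statement —
`griffiths1968_holomorphicHodgeSubbundlesQP_holds` (prover-Bx g18, `GriffithsHolomorphicHodgeSubbundlesQPHolds`).  One application each: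

* `exists_signDeck_comm_offMeagre` — for every even `d ≥ 4` a MEAGRE `M ⊆ ℂ^{M_ι}` such that every ι-even homogeneous `f` of degree `d`
  with `M_ι`-coefficient vector off `M` and every smooth projective threefold `X ⊂ ℙ⁴` cut out by `f` carry `σ : X ⟶ X` with the crux's
  clauses `Deck d X hX σ ∧ Comm X hX σ` (the `let`-block of `VeryGeneralSignCommutatorsInHg` verbatim) — NO hypothesis;
* `signThreefoldPowersHodge_offMeagre` — same quantifiers, `HodgeConjectureFor (3(k+1)) Y` for every `(k+1)`-fold self fibre power `Y` of
  `X` — NO hypothesis, axioms standard;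
* `dense_setOf_good` — the good set is dense (Baire).

HONEST FRAMING: this is the Hodge conjecture for all powers of the members of ONE explicit countable union of families of threefolds
(ι-even hypersurfaces in `ℙ⁴` of even degree `d ≥ 4`) off a MEAGRE — topologically negligible, NOT shown Lebesgue-null here, NOT a
countable union of proper Zariski-closed subsets — set of coefficient vectors; «very general» in the algebraic sense is item 19716 ∕
19715 modulo Cattani–Deligne–Kaplan (print input stmt-HodgeConjecture-23152), which stay OPEN; rung F-H1 is not moved by this file;
nothing here says HC ∕ HC_CM ∕ HC_AV is proved.

## References
* [Deligne1972WeilK3] P. Deligne, La conjecture de Weil pour les surfaces K3, Invent. Math. 15 (1972), Prop. 7.5.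
* [Andre1992] Y. André, Mumford–Tate groups of mixed Hodge structures …, Compositio Math. 82 (1992), §4 Lemma 4, §5 Thm. 1.
* [Griffiths1968PeriodsII] P. Griffiths, Periods of integrals on algebraic manifolds II, Amer. J. Math. 90 (1968), Thm. 1.1.
* [VoisinHodgeI2002] C. Voisin, Hodge Theory and Complex Algebraic Geometry I, §10.2.1 Thm. 10.3.
* [VoisinHodgeII2003] C. Voisin, Hodge Theory and Complex Algebraic Geometry II, §5.3.1 Lemma 5.13, §6.1.3, §6.2.1.
* [CarlsonMullerStachPeters2017] J. Carlson, S. Müller-Stach, C. Peters, Period Mappings and Period Domains, Def. 15.3.5, L.-D. 15.3.7.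
-/

noncomputable section

set_option linter.dupNamespace false

namespace Summit.HodgeConjecture.HodgeConjecture.Theorems.SignSymmetricPowersSignThreefoldPowersHodgeOffMeagre

open scoped TensorProduct Topology
open CategoryTheory CategoryTheory.Limits AlgebraicGeometry Set
open _root_.Topology _root_.Filter
open Literature.AlgebraicGeometry.Motives Literature.AlgebraicGeometry.HodgeTheory
open Literature.AlgebraicGeometry.HodgeTheory.BettiUniverse
open Literature.AlgebraicGeometry.Motives.UniversalHypersurface Literature.AlgebraicGeometry.HodgeTheory.UniversalHypersurface
open Literature.AlgebraicTopology.SingularHomology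

/-- **Analytic K1-B off a meagre set — UNCONDITIONAL.**  For every even `d ≥ 4` there is a MEAGRE subset `M` of the coefficient space
`ℂ^{M_ι}` of ι-even quinary forms of degree `d` such that for every ι-even homogeneous `f` of degree `d` with `M_ι`-coefficient vector off
`M`, every smooth projective threefold `X ⊂ ℙ⁴` cut out by `f` carries `σ : X ⟶ X` with the clauses `Deck ∧ Comm` of crux K1-B
`VeryGeneralSignCommutatorsInHg` (its `let`-block verbatim): `exists_signDeck_comm_offMeagre_of_griffithsQP` at the cell's theorem
`griffiths1968_holomorphicHodgeSubbundlesQP_holds`.  «Very general» is read as «off a MEAGRE set» (Deligne 1972 Prop. 7.5), NOT as the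
item's «off countably many proper Zariski-closed subsets» (⟸ Cattani–Deligne–Kaplan): item 19716 stays OPEN.
[cite: Deligne1972WeilK3, Prop. 7.5] [cite: Andre1992, §4 Lemma 4 and §5 Thm. 1] [cite: Griffiths1968PeriodsII, Thm. 1.1]
[cite: VoisinHodgeII2003, §6.1.3 and §6.2.1] [cite: CarlsonMullerStachPeters2017, Lemma–Definition 15.3.7] -/
theorem exists_signDeck_comm_offMeagre :
    open Literature.AlgebraicGeometry.Motives Literature.AlgebraicGeometry.HodgeTheory Literature.AlgebraicGeometry.HodgeTheory.BettiUniverse CategoryTheory.Limits in let pmul2 : List (ℕ × ℕ) → List (ℕ × ℕ) → List (ℕ × ℕ) := fun a b => (List.range (a.length + b.length - 1)).map fun k => (((List.range (k + 1)).map fun i => (a.getD i (0, 0)).1 * (b.getD (k - i) (0, 0)).1 + (a.getD i (0, 0)).2 * (b.getD (k - i) (0, 0)).2).sum, ((List.range (k + 1)).map fun i => (a.getD i (0, 0)).1 * (b.getD (k - i) (0, 0)).2 + (a.getD i (0, 0)).2 * (b.getD (k - i) (0, 0)).1).sum); let fac : ℕ → Bool → List (ℕ × ℕ) := fun d odd =>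 (List.range (d - 1)).map fun k => if odd ∧ ¬ Even k then (0, 1) else (1, 0); let shn : ℕ → ℕ → ℕ → ℕ := fun d j q => if (q + 1) * d < 5 then 0 else if j = 0 then (([fac d true, fac d false, fac d false, fac d false].foldl pmul2 (fac d true)).getD ((q + 1) * d - 5) (0, 0)).1 else (([fac d true, fac d false, fac d false, fac d false].foldl pmul2 (fac d true)).getD ((q + 1) * d - 5) (0, 0)).2; let Deck : (d : ℕ) → (X : SchemeOver ℂ) → IsSmoothProjective 3 X → (X ⟶ X) → Prop := fun d X hX σ => pull σ 3 ^ 2 = 1 ∧ (∀ x y, tr hX (3 + 3) (cup X 3 3 (pull σ 3 x) (pull σ 3 y)) = tr hX (3 + 3) (cup X 3 3 x y)) ∧ ∀ j q : ℕ, j < 2 → q ≤ 3 → Module.finrank ℂ ↥(Module.End.eigenspace ((pull σ 3).baseChange ℂ) ((-1 : ℂ) ^ j) ⊓ (hodge exists_isReal_hodgeModel_holds hX 3).piece ((3 : ℤ) - q) q) = shn d j q; let Cen : (X : SchemeOver ℂ) → IsSmoothProjective 3 X → (X ⟶ X) → (bettiCohomology X 3 ≃ₗ[ℚ] bettiCohomology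 X 3) → Prop := fun X hX σ g => (∀ x, g (pull σ 3 x) = pull σ 3 (g x)) ∧ ∀ x y, tr hX (3 + 3) (cup X 3 3 (g x) (g y)) = tr hX (3 + 3) (cup X 3 3 x y); let Comm : (X : SchemeOver ℂ) → IsSmoothProjective 3 X → (X ⟶ X) → Prop := fun X hX σ => haveI := finite hX 3; haveI : HodgeTensorFacts.{0, 0} := hodgeTensorFacts_holds; ∀ g h : bettiCohomology X 3 ≃ₗ[ℚ] bettiCohomology X 3, Cen X hX σ g → Cen X hX σ h → g * h * g⁻¹ * h⁻¹ ∈ (hodge exists_isReal_hodgeModel_holds hX 3).hodgeGroup; ∀ ⦃d : ℕ⦄, Even d → 4 ≤ d → ∃ Mb : Set ({m : DegIndex 3 d | Even (m.1 0 + m.1 1)} → ℂ), IsMeagre Mb ∧ ∀ f : MvPolynomial (Fin 5) ℂ, f.IsHomogeneous d → (∀ e : Fin 5 →₀ ℕ, ¬ Even (e 0 + e 1) → f.coeff e = 0) → (fun m : {m : DegIndex 3 d | Even (m.1 0 + m.1 1)} => f.coeff m.1.1) ∉ Mb → ∀ ⦃X : SchemeOver ℂ⦄ (hX : IsSmoothProjective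 3 X), IsHypersurfaceCutOutBy 4 f X → ∃ σ : X ⟶ X, Deck d X hX σ ∧ Comm X hX σ :=
  exists_signDeck_comm_offMeagre_of_griffithsQP griffiths1968_holomorphicHodgeSubbundlesQP_holds

/-- **The rung-F-H1 leaf off a meagre set — UNCONDITIONAL: the Hodge conjecture holds on ALL self fibre powers of every smooth threefold
`X ⊂ ℙ⁴` cut out by an ι-even form of even degree `d ≥ 4` whose coefficient vector lies off ONE MEAGRE subset of `ℂ^{M_ι}`.**  For every
even `d ≥ 4` there is a meagre `M ⊆ ℂ^{M_ι}` such that for every ι-even homogeneous `F` of degree `d` with `M_ι`-coefficient vector off `M`,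
every smooth projective `X` cut out in `ℙ⁴` by `F` and every `(k+1)`-fold self fibre power `Y` of `X`: `HodgeConjectureFor (3(k+1)) Y`.
`signThreefoldPowersHodge_offMeagre_of_griffithsQP` at `griffiths1968_holomorphicHodgeSubbundlesQP_holds`; NO hypothesis, axioms standard.
The leaf `SignThreefoldPowersHodge` (item 19715, Zariski-very-general) and crux K1-B (19716) stay OPEN ⟸ CDK; HC not proved.
[cite: Deligne1972WeilK3, Prop. 7.5] [cite: Andre1992, §4 Lemma 4 and §5 Thm. 1] [cite: Griffiths1968PeriodsII, Thm. 1.1]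
[cite: VoisinHodgeII2003, §6.1.3 and §6.2.1] [cite: CarlsonMullerStachPeters2017, Lemma–Definition 15.3.7] -/
theorem signThreefoldPowersHodge_offMeagre :
    ∀ ⦃d : ℕ⦄, Even d → 4 ≤ d →
      ∃ Mb : Set ({m : DegIndex 3 d | Even (m.1 0 + m.1 1)} → ℂ), IsMeagre Mb ∧
        ∀ F : MvPolynomial (Fin 5) ℂ, F.IsHomogeneous d → (∀ e : Fin 5 →₀ ℕ, ¬ Even (e 0 + e 1) → F.coeff e = 0) →
          (fun m : {m : DegIndex 3 d | Even (m.1 0 + m.1 1)} => F.coeff m.1.1) ∉ Mb →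
          ∀ ⦃X : SchemeOver ℂ⦄, IsSmoothProjective 3 X → IsHypersurfaceCutOutBy 4 F X →
            ∀ ⦃k : ℕ⦄ ⦃Y : SchemeOver ℂ⦄, (∃ π : Fin (k + 1) → (Y ⟶ X), Nonempty (IsLimit (Fan.mk Y π))) →
              HodgeConjectureFor (3 * (k + 1)) Y :=
  signThreefoldPowersHodge_offMeagre_of_griffithsQP griffiths1968_holomorphicHodgeSubbundlesQP_holds

/-- **The good set is dense**: for every even `d ≥ 4` there is a DENSE set `G ⊆ ℂ^{M_ι}` of coefficient vectors (the complement of the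
meagre set of `signThreefoldPowersHodge_offMeagre`; Baire) such that every ι-even `F` with coefficient vector in `G`, every smooth `X` cut
out by `F` and every self fibre power `Y` satisfy `HodgeConjectureFor (3(k+1)) Y`. [cite: Deligne1972WeilK3, Prop. 7.5] -/
theorem dense_setOf_good :
    ∀ ⦃d : ℕ⦄, Even d → 4 ≤ d →
      ∃ G : Set ({m : DegIndex 3 d | Even (m.1 0 + m.1 1)} → ℂ), Dense G ∧
        ∀ F : MvPolynomial (Fin 5) ℂ, F.IsHomogeneous d → (∀ e : Fin 5 →₀ ℕ, ¬ Even (e 0 + e 1) → F.coeff e = 0) →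
          (fun m : {m : DegIndex 3 d | Even (m.1 0 + m.1 1)} => F.coeff m.1.1) ∈ G →
          ∀ ⦃X : SchemeOver ℂ⦄, IsSmoothProjective 3 X → IsHypersurfaceCutOutBy 4 F X →
            ∀ ⦃k : ℕ⦄ ⦃Y : SchemeOver ℂ⦄, (∃ π : Fin (k + 1) → (Y ⟶ X), Nonempty (IsLimit (Fan.mk Y π))) →
              HodgeConjectureFor (3 * (k + 1)) Y := by
  intro d hd h4
  obtain ⟨Mb, hMb, h⟩ := signThreefoldPowersHodge_offMeagre hd h4
  exact ⟨Mbᶜ, dense_compl_of_isMeagre_coeffs hMb, fun F hF hev hG => h F hF hev hG⟩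

end Summit.HodgeConjecture.HodgeConjecture.Theorems.SignSymmetricPowersSignThreefoldPowersHodgeOffMeagre
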